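import Summits.Ventures.CertifiedQuantumChemistry.Certificates.HubbardRingL6LiftBlockG0
import Summits.Ventures.CertifiedQuantumChemistry.Rows.KernelFacialReduction
import HarnessLib

/-!
# Ventures/CertifiedQuantumChemistry — Certificates/HubbardRingL6LiftBlockG0Face.lean: the FULL 72-dimensional `G_0` block of the exact L = 6
# lift is positive semidefinite along the family — the reduced certificate `l6G0_psd` lifted through the facial reduction of the block's one
# forced kernel direction (`Rows/KernelFacialReduction.lean`)

HONEST FRAMING (verbatim): certified bounds for a stated model Hamiltonian in a stated basis; not a
claim about the real molecule beyond that model. Auxiliary object; no model energy is bounded here.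

Seat rdm-B (gen 42). The `G_0` block (like-spin particle–hole pairs, dimension 72) of the lift family `X(ε) = X₀ + εX₁ + ε²X₂` has ONE
common kernel direction `f` of `X₀, X₁, X₂` (the `2Ŝ_z`-type alternating vector on the diagonal pairs `(iσ, iσ)`, last entry `1`):
`X_j·f = 0` (kernel, §1). By the index-dropping facial reduction (`posSemidef_iff_submatrix_of_mul_eq_zero` with `finSumFinEquiv :
Fin 71 ⊕ Fin 1 ≃ Fin 72`, the dropped row of `f` being the invertible `1×1` block), `X(ε) ⪰ 0` iff its principal `71×71` submatrix is —
which is `…LiftBlockG0.lean`'s `l6G0_psd`. THE THEOREM **`l6G0_psd72`**. 0 sorry; standard axioms.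
-/

set_option linter.style.longLine false

namespace Summit.Ventures.CertifiedQuantumChemistry

namespace LiftL6

open Matrix Finset PencilRat

/-! ## §1 The full tables and the forced direction -/

/-- The three coefficient tables of `G_0` on the FULL index set `Fin 72` (same data as `…LiftBlockG0Tables.lean`). -/
noncomputable def l6G0X72 : Fin 3 → Fin 72 → Fin 72 → ℚ := fun j i i' =>
  ((( (![l6G0X0T, l6G0X1T, l6G0X2T] : Fin 3 → Fin 8 → Fin 9 → Fin 8 → Fin 9 → ℤ) j) ⟨i.val / 9, by omega⟩ ⟨i.val % 9, by omega⟩ ⟨i'.val / 9, by omega⟩ ⟨i'.val % 9, by omega⟩ : ℤ) : ℚ) / l6G0den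

/-- The forced kernel direction `f` (alternating on the diagonal pairs; `f 71 = 1`). -/
def l6G0f : Fin 72 → ℚ :=
  ![(-1 : ℚ), (0 : ℚ), (0 : ℚ), (0 : ℚ), (0 : ℚ), (0 : ℚ), (1 : ℚ), (0 : ℚ), (0 : ℚ), (0 : ℚ), (0 : ℚ), (0 : ℚ), (0 : ℚ), (-1 : ℚ), (0 : ℚ), (0 : ℚ), (0 : ℚ), (0 : ℚ), (0 : ℚ), (1 : ℚ), (0 : ℚ), (0 : ℚ), (0 : ℚ), (0 : ℚ), (0 : ℚ), (0 : ℚ), (-1 : ℚ), (0 : ℚ), (0 : ℚ), (0 : ℚ), (0 : ℚ), (0 : ℚ), (1 : ℚ), (0 : ℚ), (0 : ℚ), (0 : ℚ), (0 : ℚ), (0 : ℚ), (0 : ℚ), (-1 : ℚ), (0 : ℚ), (0 : ℚ), (0 : ℚ), (0 : ℚ), (0 : ℚ), (1 : ℚ), (0 : ℚ), (0 : ℚ), (0 : ℚ), (0 : ℚ), (0 : ℚ), (0 : ℚ), (-1 : ℚ), (0 : ℚ), (0 : ℚ), (0 : ℚ), (0 : ℚ), (0 : ℚ), (1 : ℚ),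 (0 : ℚ), (0 : ℚ), (0 : ℚ), (0 : ℚ), (0 : ℚ), (0 : ℚ), (-1 : ℚ), (0 : ℚ), (0 : ℚ), (0 : ℚ), (0 : ℚ), (0 : ℚ), (1 : ℚ)]

/-- `X_j · f = 0` for `j = 0, 1, 2` (kernel). -/
theorem l6G0_f_kernel : ∀ (j : Fin 3) (i : Fin 72), ∑ k, l6G0X72 j i k * l6G0f k = 0 := by
  decide +kernel

/-- Symmetry of the full tables (kernel). -/
theorem l6G0X72_symm : ∀ (j : Fin 3) (i k : Fin 72), l6G0X72 j i k = l6G0X72 j k i := by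
  decide +kernel

/-- The reduced tables are the principal `71×71` part of the full ones (same accessor). -/
theorem l6G0X72_castSucc (j : Fin 3) (i i' : Fin 71) : l6G0X72 j (Fin.castAdd 1 i) (Fin.castAdd 1 i') = l6G0X j i i' := rfl

/-! ## §2 The full block is PSD along the family -/

/-- **THE FULL `G_0` BLOCK OF THE L = 6 LIFT IS PSD ALONG THE FAMILY**: for `0 < ε ≤ 1` with `ε·(ρ₁ + ρ₂) ≤ μ`,
`X(ε) ⪰ 0` on `Fin 72` — the reduced certificate lifted through the facial reduction of the forced direction `f`. -/
theorem l6G0_psd72 {ε : ℝ} (hε0 : 0 < ε) (hε1 : ε ≤ 1) (hεμ : ε * ((l6G0rho1 + l6G0rho2 : ℚ) : ℝ) ≤ (l6G0mu : ℝ)) :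
    (realXQ l6G0X72 ε).PosSemidef := by
  have hred := l6G0_psd hε0 hε1 hεμ
  set B : Matrix (Fin 72) (Fin 72) ℝ := realXQ l6G0X72 ε with hBdef
  set Wf : Matrix (Fin 72) (Fin 1) ℝ := fun i _ => ((l6G0f i : ℚ) : ℝ) with hWf
  have hB : B.IsHermitian := by
    refine Matrix.IsHermitian.ext fun i k => ?_
    rw [hBdef, realXQ_apply, realXQ_apply, star_trivial, l6G0X72_symm 0 k i, l6G0X72_symm 1 k i, l6G0X72_symm 2 k i]
  have hBW : B * Wf = 0 := by
    ext i t
    rw [Matrix.mul_apply, Matrix.zero_apply]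
    simp only [hBdef, hWf, realXQ_apply]
    have h0 : ∑ k, ((l6G0X72 0 i k : ℚ) : ℝ) * ((l6G0f k : ℚ) : ℝ) = 0 := by exact_mod_cast l6G0_f_kernel 0 i
    have h1 : ∑ k, ((l6G0X72 1 i k : ℚ) : ℝ) * ((l6G0f k : ℚ) : ℝ) = 0 := by exact_mod_cast l6G0_f_kernel 1 i
    have h2 : ∑ k, ((l6G0X72 2 i k : ℚ) : ℝ) * ((l6G0f k : ℚ) : ℝ) = 0 := by exact_mod_cast l6G0_f_kernel 2 i
    have e : ∀ k, (((l6G0X72 0 i k : ℚ) : ℝ) + ε * ((l6G0X72 1 i k : ℚ) : ℝ) + ε ^ 2 * ((l6G0X72 2 i k : ℚ) : ℝ)) * ((l6G0f k : ℚ) : ℝ) =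
        ((l6G0X72 0 i k : ℚ) : ℝ) * ((l6G0f k : ℚ) : ℝ) + ε * (((l6G0X72 1 i k : ℚ) : ℝ) * ((l6G0f k : ℚ) : ℝ)) +
          ε ^ 2 * (((l6G0X72 2 i k : ℚ) : ℝ) * ((l6G0f k : ℚ) : ℝ)) := fun k => by ring
    simp_rw [e, Finset.sum_add_distrib, ← Finset.mul_sum, h0, h1, h2, mul_zero, add_zero]
  let e : Fin 71 ⊕ Fin 1 ≃ Fin 72 := finSumFinEquiv
  haveI : Invertible ((Wf.submatrix e id).toRows₂) := by
    refine Matrix.invertibleOfIsUnitDet _ ?_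
    rw [Matrix.det_fin_one]
    have hval : (Wf.submatrix e id).toRows₂ 0 0 = 1 := by
      simp only [Matrix.toRows₂, Matrix.submatrix_apply, Matrix.of_apply, hWf]
      have h71 : e (Sum.inr 0) = ⟨71, by omega⟩ := by decide
      rw [h71]
      have hf : l6G0f ⟨71, by omega⟩ = 1 := by decide
      rw [hf]; norm_num
    rw [hval]; exact isUnit_one
  rw [posSemidef_iff_submatrix_of_mul_eq_zero hB hBW e]
  have hsub : B.submatrix (e ∘ Sum.inl) (e ∘ Sum.inl) = realXQ l6G0X ε := by
    ext i i'
    simp only [Matrix.submatrix_apply, Function.comp_apply, hBdef, realXQ_apply]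
    have hi : e (Sum.inl i) = Fin.castAdd 1 i := finSumFinEquiv_apply_left i
    have hi' : e (Sum.inl i') = Fin.castAdd 1 i' := finSumFinEquiv_apply_left i'
    rw [hi, hi', l6G0X72_castSucc, l6G0X72_castSucc, l6G0X72_castSucc]
  rw [hsub]
  exact hred

end LiftL6

end Summit.Ventures.CertifiedQuantumChemistry
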